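import Summits.MatrixMultiplication.MatrixMultiplication.Theorems.TetraTwinCliqueLadder
import HarnessLib

/-!
# TetraTwinCliqueCuts — the cut of record `closes (TetraExcessZero) (TetraPlusTwo)` is member `a = 2` of
the twin-clique FAMILY OF CUTS `cut_a = (L(a), B(a))`, `a ≥ 2`; every member decides `ω = 2`; the residual
side `B(a) : ω + 2a − 2 ≤ ω(T(K_{a+2}))` is NECESSARY for every `a` and a THEOREM for `a ≥ 4`, while the
leaf side `L(a) : ω(T(K_{a+2})) ≤ ω(1,a,a)` is false for `a ≥ 4` (`TetraTwinCliqueLadder`); so `a = 2` is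
the last index at which both pieces are certified necessary — the route's cut is RIGID in its family

(decomp-mm lens 6 «barrier-complement carving», generation 36, second kernel; `--supports` the attacked
leaf stmt-MatrixMultiplication-26697; cut of record UNCHANGED.)

 * §1 THE CHORD at clique size `a`: `ω(1, a, a) = a·ω(1, 1, 1/a) ≤ 2a + (ω − 2)·(1 − 0.1722·a)/0.8` for
   `1 ≤ a ≤ 5` (homogeneity + symmetry + the Lotti–Romani/Coppersmith chord `omegaRect_le_interpolation`).
 * §2 THE RESIDUAL LADDER `B(a)`: `B(1)` trivially; `B(2) ↔ TetraPlusTwo` (by name at `ℂ`); `ω = 2 → B(a)`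
   for EVERY `a` (max-cut `⌊(a+2)²/4⌋ ≥ 2a`: NEC); **`B(a)` PROVED for every `a ≥ 4`** (`ω ≤ 3` and
   `⌊(a+2)²/4⌋ ≥ 2a + 1`): the same max-cut flattening that refutes the leaf side proves the residual side.
 * §3 THE FAMILY OF CUTS: for every `a ≥ 2`, `L(a) → B(a) → ω = 2` over every field (`cut_closes`; at
   `a ≥ 4` vacuously, at `a = 2, 3` by the chord: `(ω−2)·(0.1722a − 0.2)/0.8 ≤ 0`); at `ℂ` and `a = 2` this is
   literally the route's deciding theorem (`cut_two_iff_route`).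
 * §4 NEC TABLE: `(ω = 2 → L(a)) ↔ ¬(ω = 2)` for `a ≥ 4` (certifying a dead rung necessary = refuting the
   summit); `(ω = 2 → L(3)) ↔ (ω = 2 → ω(T(K₅)) = 6)` (CVZ19 Problem 1.2.1 at `k = 5`, conditionally open);
   `ω = 2 → L(2)` (tree). Hence among `a ≥ 2` only `a = 2` has BOTH pieces NEC-certified with neither refuted:
   the tetrahedron carving is not one choice among many in its family — it is the family's unique live member.
No `sorry`, no new definition, no named-fact hypothesis.
-/

noncomputable section

set_option linter.dupNamespace false

open Literature.Computability.AlgebraicComplexity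
open Summit.MatrixMultiplication.MatrixMultiplication.Theorems.TetrahedronTensor
open Summit.MatrixMultiplication.MatrixMultiplication.Theorems.TetraTwinCliqueLadder

namespace Summit.MatrixMultiplication.MatrixMultiplication.Theorems.TetraTwinCliqueCuts

/-! ## §1 The chord at clique size `a` -/

section Chord

variable (F : Type) [Field F]

/-- `ω(1, a, a) = a · ω(1, 1, 1/a)` for `a > 0` (homogeneity and symmetry). [cite: LottiRomani1983, §1 (p. 173)] -/
theorem omegaRect_one_eq_mul_inv {a : ℝ} (ha : 0 < a) :
    omegaRect F 1 a a = a * omegaRect F 1 1 (1 / a) := by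
  have h := LottiRomani1983_homogeneous F ha.le (by positivity : (0 : ℝ) ≤ 1 / a) zero_le_one zero_le_one
  rw [mul_one_div_cancel ha.ne', mul_one] at h
  rw [h, omegaRect_swap₁₃ F (1 / a) 1 1]

/-- **The chord**: `ω(1, a, a) ≤ 2a + (ω − 2)·(1 − 0.1722·a)/0.8` for `1 ≤ a ≤ 5` (the Lotti–Romani
convexity chord between Coppersmith's point `(α₀, 2)` and `(1, ω)`, evaluated at `k = 1/a ≥ 1/5 > α₀`, times `a`).
[cite: LottiRomani1983, §3 (p. 179)] [cite: Coppersmith1982, Thm. 1] -/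
theorem omegaRect_one_le_chord {a : ℝ} (h1 : 1 ≤ a) (h5 : a ≤ 5) :
    omegaRect F 1 a a ≤ 2 * a + (omega F - 2) * ((1 - 0.1722 * a) / 0.8) := by
  have ha : 0 < a := by linarith
  have hcE := coppersmithExponent_lt
  have hk₀ : coppersmithExponent ≤ 1 / a := by
    rw [le_div_iff₀ ha]
    nlinarith
  have hk₁ : 1 / a ≤ 1 := (div_le_one ha).2 h1
  have hch := coppersmith1982_omegaRect_le_interpolation_numeric F hk₀ hk₁
  rw [omegaRect_one_eq_mul_inv F ha]
  have hmul := mul_le_mul_of_nonneg_left hch ha.le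
  have e : a * (2 + (omega F - 2) * ((1 / a - 0.1722) / 0.8)) =
      2 * a + (omega F - 2) * ((1 - 0.1722 * a) / 0.8) := by
    field_simp
  linarith [hmul, e.le]

/-- The chord closes every cut of the family with `2 ≤ a ≤ 5`: if `ω + 2a − 2 ≤ X ≤ ω(1, a, a)` then `ω = 2`
(`(ω − 2)·(1 − (1 − 0.1722a)/0.8) ≤ 0` with `0.1722a − 0.2 > 0`). [cite: Coppersmith1982, Thm. 1] -/
theorem omega_eq_two_of_sandwich {a X : ℝ} (h2 : 2 ≤ a) (h5 : a ≤ 5) (hL : X ≤ omegaRect F 1 a a)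
    (hB : omega F + 2 * a - 2 ≤ X) : omega F = 2 := by
  have hch := omegaRect_one_le_chord F (by linarith) h5
  have hω := omega_two_le F
  have hc : (1 - 0.1722 * a) / 0.8 ≤ 0.8195 := by
    rw [div_le_iff₀ (by norm_num : (0 : ℝ) < 0.8)]
    linarith
  have hprod : (omega F - 2) * ((1 - 0.1722 * a) / 0.8) ≤ (omega F - 2) * 0.8195 :=
    mul_le_mul_of_nonneg_left hc (by linarith)
  refine le_antisymm ?_ hω
  nlinarith

end Chord

/-! ## §2 The residual ladder `B(a) : ω + 2a − 2 ≤ ω(T(K_{a+2}))` -/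

section Residual

variable (F : Type) [Field F]

/-- `B(1)` with equality: `ω = ω(T(K₃))`. [cite: ChristandlVranaZuiddam2016, Ex. 1.1.2] -/
theorem residualRung_one : omega F + 2 * 1 - 2 ≤ graphOmega F (cliqueSlots 2) := by
  rw [graphOmega_cliqueSlots_two]
  linarith

/-- `B(2)` is `ω + 2 ≤ ω(T(K₄))`. [cite: ChristandlVranaZuiddam2016, §1.2] -/
theorem residualRung_two_iff :
    omega F + 2 * 2 - 2 ≤ graphOmega F (cliqueSlots 3) ↔ omega F + 2 ≤ omegaTetra F := by
  rw [graphOmega_cliqueSlots_three_eq]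
  constructor <;> intro h <;> linarith

/-- At `ℂ`: **`B(2) ↔ TetraPlusTwo`** (item stmt-MatrixMultiplication-27058, by name).
[cite: ChristandlVranaZuiddam2016, §1.2] -/
theorem residualRung_two_iff_tetraPlusTwo :
    omega ℂ + 2 * 2 - 2 ≤ graphOmega ℂ (cliqueSlots 3) ↔ Theses.TetrahedronCarving.TetraPlusTwo :=
  (residualRung_two_iff ℂ).trans Iff.rfl

/-- `2a ≤ ⌊(a+2)²/4⌋` for every `a` (`(a+2)² − 8a = (a−2)² ≥ 0`). [cite: ChristandlVranaZuiddam2016, §1.2 (eq. (1.4))] -/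
theorem two_mul_le_maxcut (a : ℕ) : 2 * a ≤ (a + 2) ^ 2 / 4 := by
  rw [Nat.le_div_iff_mul_le (by norm_num : 0 < 4)]
  zify
  nlinarith [sq_nonneg ((a : ℤ) - 2)]

/-- **`B(a)` is NECESSARY for every `a`**: `ω = 2 → ω + 2a − 2 = 2a ≤ ⌊(a+2)²/4⌋ ≤ ω(T(K_{a+2}))`
(max-cut flattening), over every field. [cite: ChristandlVranaZuiddam2016, §1.2 (eq. (1.4))] -/
theorem residualRung_of_omega_eq_two (hω : omega F = 2) (a : ℕ) :
    omega F + 2 * a - 2 ≤ graphOmega F (cliqueSlots (a + 1)) := by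
  have h1 : ((2 * a : ℕ) : ℝ) ≤ (((a + 2) ^ 2 / 4 : ℕ) : ℝ) := by exact_mod_cast two_mul_le_maxcut a
  have h2 := maxcut_le_graphOmega_clique F a
  push_cast at h1
  rw [hω]
  linarith

/-- At `ℂ`: `ω = 2 → B(a)` for every `a`. [cite: ChristandlVranaZuiddam2016, §1.2 (eq. (1.4))] -/
theorem residualRung_of_matrixMultiplication (hS : _root_.MatrixMultiplication) (a : ℕ) :
    omega ℂ + 2 * a - 2 ≤ graphOmega ℂ (cliqueSlots (a + 1)) :=
  residualRung_of_omega_eq_two ℂ ((_root_.MatrixMultiplication_iff).1 hS) a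

/-- **`B(a)` is a THEOREM for every `a ≥ 4`**: `ω + 2a − 2 ≤ 2a + 1 ≤ ⌊(a+2)²/4⌋ ≤ ω(T(K_{a+2}))`
(`ω ≤ 3`), over every field. [cite: ChristandlVranaZuiddam2016, §1.2 (eq. (1.4))] -/
theorem residualRung_of_four_le {a : ℕ} (ha : 4 ≤ a) :
    omega F + 2 * a - 2 ≤ graphOmega F (cliqueSlots (a + 1)) := by
  have h1 : ((2 * a + 1 : ℕ) : ℝ) ≤ (((a + 2) ^ 2 / 4 : ℕ) : ℝ) := by
    exact_mod_cast two_mul_add_one_le_maxcut ha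
  have h2 := maxcut_le_graphOmega_clique F a
  have h3 := omega_le_three' F
  push_cast at h1
  linarith

/-- `B(3)` reads `ω + 4 ≤ ω(T(K₅))`; the recorded lower bound is only `6 ≤ ω(T(K₅))`, so `B(3)` is open
(and NEC). [cite: ChristandlVranaZuiddam2016, Problem 1.2.1] -/
theorem residualRung_three_iff :
    omega F + 2 * 3 - 2 ≤ graphOmega F (cliqueSlots 4) ↔ omega F + 4 ≤ graphOmega F (cliqueSlots 4) := by
  constructor <;> intro h <;> linarith

end Residual

/-! ## §3 The family of cuts `cut_a = (L(a), B(a))`, `a ≥ 2`: every member decides `ω = 2` -/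

section Cuts

variable (F : Type) [Field F]

/-- **Every cut of the family closes**: for `a ≥ 2`, `L(a) → B(a) → ω = 2`, over every field
(`a ≥ 4`: `L(a)` is false; `a = 2, 3`: the chord). [cite: Coppersmith1982, Thm. 1] [cite: ChristandlVranaZuiddam2016, §1.2 (eq. (1.4))] -/
theorem cut_closes {a : ℕ} (ha : 2 ≤ a)
    (hL : graphOmega F (cliqueSlots (a + 1)) ≤ omegaRect F 1 a a)
    (hB : omega F + 2 * a - 2 ≤ graphOmega F (cliqueSlots (a + 1))) : omega F = 2 := by
  rcases Nat.lt_or_ge a 4 with h4 | h4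
  · have h2 : (2 : ℝ) ≤ a := by exact_mod_cast ha
    have h5 : (a : ℝ) ≤ 5 := by exact_mod_cast (show a ≤ 5 by omega)
    exact omega_eq_two_of_sandwich F h2 h5 hL hB
  · exact absurd hL (not_cliqueRung_of_four_le F h4)

/-- At `ℂ`: every cut of the family decides the summit. [cite: Coppersmith1982, Thm. 1] -/
theorem matrixMultiplication_of_cut {a : ℕ} (ha : 2 ≤ a)
    (hL : graphOmega ℂ (cliqueSlots (a + 1)) ≤ omegaRect ℂ 1 a a)
    (hB : omega ℂ + 2 * a - 2 ≤ graphOmega ℂ (cliqueSlots (a + 1))) : _root_.MatrixMultiplication :=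
  (_root_.MatrixMultiplication_iff).2 (cut_closes ℂ ha hL hB)

/-- Conversely `ω = 2` gives `B(a)` always and `L(a)` for `a ≤ 2`: so for `a = 2` the cut is EXACT,
`ω = 2 ↔ L(2) ∧ B(2)`. [cite: ChristandlVranaZuiddam2016, §1.3] -/
theorem matrixMultiplication_iff_cut_two :
    _root_.MatrixMultiplication ↔
      graphOmega ℂ (cliqueSlots 3) ≤ omegaRect ℂ 1 2 2 ∧ omega ℂ + 2 * 2 - 2 ≤ graphOmega ℂ (cliqueSlots 3) := by
  refine ⟨fun hS => ⟨cliqueRung_two_of_matrixMultiplication hS, ?_⟩, fun h => ?_⟩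
  · have := residualRung_of_matrixMultiplication hS 2
    exact_mod_cast this
  · have hB : omega ℂ + 2 * ((2 : ℕ) : ℝ) - 2 ≤ graphOmega ℂ (cliqueSlots (2 + 1)) := by
      exact_mod_cast h.2
    exact matrixMultiplication_of_cut le_rfl (by exact_mod_cast h.1) hB

/-- **`cut_2` IS the route's cut**: its two hypotheses are `TetraExcessZero` and `TetraPlusTwo` by name.
[cite: ChristandlVranaZuiddam2016, Problem 1.2.1] -/
theorem cut_two_iff_route :
    (graphOmega ℂ (cliqueSlots 3) ≤ omegaRect ℂ 1 2 2 ↔ Theses.TetrahedronCarving.TetraExcessZero) ∧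
    (omega ℂ + 2 * 2 - 2 ≤ graphOmega ℂ (cliqueSlots 3) ↔ Theses.TetrahedronCarving.TetraPlusTwo) :=
  ⟨cliqueRung_two_iff_tetraExcessZero, residualRung_two_iff_tetraPlusTwo⟩

/-- `cut_3 = (ω(T(K₅)) ≤ ω(1,3,3), ω + 4 ≤ ω(T(K₅)))` also decides the summit — a sibling cut whose leaf is
NOT certified necessary (`TetraTwinCliqueLadder.cliqueRung_three_iff_of_matrixMultiplication`).
[cite: Coppersmith1982, Thm. 1] -/
theorem matrixMultiplication_of_cut_three (hL : graphOmega ℂ (cliqueSlots 4) ≤ omegaRect ℂ 1 3 3)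
    (hB : omega ℂ + 4 ≤ graphOmega ℂ (cliqueSlots 4)) : _root_.MatrixMultiplication := by
  have hB' : omega ℂ + 2 * ((3 : ℕ) : ℝ) - 2 ≤ graphOmega ℂ (cliqueSlots (3 + 1)) := by
    push_cast; linarith
  exact matrixMultiplication_of_cut (by norm_num) (by exact_mod_cast hL) hB'

end Cuts

/-! ## §4 The NEC table: which pieces of `cut_a` are certified necessary -/

section NecTable

/-- **For `a ≥ 4`, certifying the leaf `L(a)` necessary is REFUTING the summit**: `(ω = 2 → L(a)) ↔ ω ≠ 2`.
[cite: ChristandlVranaZuiddam2016, §1.2 (eq. (1.4))] -/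
theorem nec_leafRung_iff_not_of_four_le {a : ℕ} (ha : 4 ≤ a) :
    (_root_.MatrixMultiplication → graphOmega ℂ (cliqueSlots (a + 1)) ≤ omegaRect ℂ 1 a a) ↔
      ¬ _root_.MatrixMultiplication :=
  ⟨fun h hS => not_cliqueRung_of_four_le ℂ ha (h hS), fun h hS => absurd hS h⟩

/-- **For `a = 3`, certifying the leaf necessary is settling `K₅` under `ω = 2`**:
`(ω = 2 → L(3)) ↔ (ω = 2 → ω(T(K₅)) = 6)`. [cite: ChristandlVranaZuiddam2016, Problem 1.2.1] [cite: BrandEtAl2026, Remark 21] -/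
theorem nec_leafRung_three_iff :
    (_root_.MatrixMultiplication → graphOmega ℂ (cliqueSlots 4) ≤ omegaRect ℂ 1 3 3) ↔
      (_root_.MatrixMultiplication → graphOmega ℂ (cliqueSlots 4) = 6) :=
  ⟨fun h hS => (cliqueRung_three_iff_of_matrixMultiplication hS).1 (h hS),
    fun h hS => (cliqueRung_three_iff_of_matrixMultiplication hS).2 (h hS)⟩

/-- **For `a ≤ 2` both pieces are NEC** (and `B(a)` is NEC for every `a`): the full certified table.
[cite: ChristandlVranaZuiddam2016, §1.3] -/
theorem nec_table (hS : _root_.MatrixMultiplication) :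
    graphOmega ℂ (cliqueSlots 1) ≤ omegaRect ℂ 1 0 0 ∧
    graphOmega ℂ (cliqueSlots 2) ≤ omegaRect ℂ 1 1 1 ∧
    graphOmega ℂ (cliqueSlots 3) ≤ omegaRect ℂ 1 2 2 ∧
    (∀ a : ℕ, omega ℂ + 2 * a - 2 ≤ graphOmega ℂ (cliqueSlots (a + 1))) ∧
    (∀ a : ℕ, 4 ≤ a → ¬ graphOmega ℂ (cliqueSlots (a + 1)) ≤ omegaRect ℂ 1 a a) :=
  ⟨cliqueRung_zero ℂ, cliqueRung_one ℂ, cliqueRung_two_of_matrixMultiplication hS,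
    residualRung_of_matrixMultiplication hS, fun _ ha => not_cliqueRung_of_four_le ℂ ha⟩

/-- **RIGIDITY OF THE CUT OF RECORD (summary).** In the family `cut_a`, `a ≥ 2`: every member decides the
summit (`cut_closes`); the residual `B(a)` is NEC for all `a` and PROVED for `a ≥ 4`; the leaf `L(a)` is
REFUTED for `a ≥ 4` and uncertified at `a = 3`; `a = 2` — the tetrahedron carving — is the unique member with
both pieces certified necessary and neither refuted. [cite: ChristandlVranaZuiddam2016, Problem 1.2.1] -/
theorem rigidity :
    (∀ a : ℕ, 2 ≤ a → graphOmega ℂ (cliqueSlots (a + 1)) ≤ omegaRect ℂ 1 a a →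
        omega ℂ + 2 * a - 2 ≤ graphOmega ℂ (cliqueSlots (a + 1)) → _root_.MatrixMultiplication) ∧
    (∀ a : ℕ, 4 ≤ a → omega ℂ + 2 * a - 2 ≤ graphOmega ℂ (cliqueSlots (a + 1))) ∧
    (∀ a : ℕ, 4 ≤ a → ¬ graphOmega ℂ (cliqueSlots (a + 1)) ≤ omegaRect ℂ 1 a a) ∧
    (_root_.MatrixMultiplication → graphOmega ℂ (cliqueSlots 3) ≤ omegaRect ℂ 1 2 2) ∧
    (_root_.MatrixMultiplication → ∀ a : ℕ, omega ℂ + 2 * a - 2 ≤ graphOmega ℂ (cliqueSlots (a + 1))) :=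
  ⟨fun _ ha hL hB => matrixMultiplication_of_cut ha hL hB, fun _ ha => residualRung_of_four_le ℂ ha,
    fun _ ha => not_cliqueRung_of_four_le ℂ ha, cliqueRung_two_of_matrixMultiplication,
    residualRung_of_matrixMultiplication⟩

end NecTable

end Summit.MatrixMultiplication.MatrixMultiplication.Theorems.TetraTwinCliqueCuts

end
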